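import Literature.IUT.HodgeTheaters.TemperedCoveringsCor23viSurfaceTypeCharacters
import HarnessLib

/-!
# [IUTchI] Cor. 2.3 (vi) at surface type, II: two `ℤ/ℓ`-characters of an edge group differ by a unit; `GL₂(𝔽_ℓ)` is
# transitive on non-zero vectors; the INTERTWINERS gluing translation coverings along an edge ([SemiAnbd] Ex. 2.10)

S. Mochizuki, *Semi-graphs of anabelioids*, Publ. RIMS **42** (2006), Example 2.10 p. 31, §3 p. 36 (objects of
`B^cov(𝒢)`: `Π_v`-, `Π_e`-sets glued along the branches) [cite: MochizukiSemiAnbd2006, Ex. 2.10 p.31]; [IUTchI] Cor. 2.3 (vi)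
pp. 48–49 [cite: Mochizuki2012, Cor 2.3(vi) pp.48-49] (D-0012 claim key; series DISPUTED; nothing of it is asserted here).

PROOF-ONLY file (abc-iut cell, seat abc-iut-L5-d5 gen 10, row «COR23VI-HF-TWO-LEVEL@CAVEAT», part (2b); sequel of
`TemperedCoveringsCor23viSurfaceTypeCharacters.lean`; no definition, no instance, no notation, no `Prop` fact):

* §0.5 **`exists_unit_mul_of_dense_zpowers`** — two NON-TRIVIAL characters `δ, δ' : K → ℤ/ℓ` with open kernels of a
  Hausdorff group with a dense cyclic subgroup satisfy `δ' = u · δ` for a unit `u` (their kernels are THE closed subgroup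
  of index `ℓ`);
* §0.6 `continuous_of_isOpen_ker`; `exists_functional_eq_one`, `eq_smul_of_mem_zmultiples` (coordinates on a line of
  `𝔽_ℓ²`); **`exists_addEquiv_apply_eq`** (`GL₂(𝔽_ℓ)` moves any non-zero vector to any other); and the two gluing engines:
  **`exists_intertwiner`** — non-trivial characters `ψ, ψ' : K → 𝔽_ℓ²` with open kernels and values on the lines through
  `d, d' ≠ 0` have ISOMORPHIC translation actions on `𝔽_ℓ²` (a bijection `A` with `A(ψ' t · m) = ψ t · A m`: `ψ = d·δ`,
  `ψ' = d'·δ'`, `δ = u·δ'`, `A` linear with `A d' = u·d`); **`exists_intertwiner_zmod`** — the rank-one twin.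

These are exactly the isomorphisms of `Π_e`-sets `S_e ≅ b^* S_v` demanded by an object of `B^cov(𝒢)` for the
translation coverings of the sequel.  HONEST SCOPE: elementary; nothing of [SemiAnbd]/[IUTchI] is asserted; no side taken
on [IUTchIII] Cor. 3.12; nothing here asserts that abc is proved or refuted.
-/

noncomputable section

namespace Literature.IUT.HodgeTheaters

open _root_.Topology
open scoped Pointwise
open Literature.AnabelianGeometry.SemiGraphs
open Literature.AnabelianGeometry.SemiGraphs.SemiGraphOfAnabelioids (IsProSigmaCompletion)
open Literature.AnabelianGeometry.Anabelioids (IsSigmaInteger)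
open Literature.GroupTheory.CombinatorialGroupTheory
open Literature.GroupTheory.CombinatorialGroupTheory.PuncturedSurfaceGroup
open Multiplicative

universe u

namespace SurfaceTypeCharacters

/-! ### 0.5 Two non-trivial `ℤ/ℓ`-characters of a topologically cyclic group differ by a unit -/

section Unit

variable {K : Type*} [Group K] [TopologicalSpace K] [IsTopologicalGroup K] [T2Space K]
  {ℓ : ℕ} [hℓ : Fact ℓ.Prime]

omit [TopologicalSpace K] [IsTopologicalGroup K] [T2Space K] in
/-- A non-trivial `ℤ/ℓ`-character has kernel of index `ℓ`. [cite: MochizukiSemiAnbd2006, Ex. 2.10 p.31] -/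
theorem index_ker_eq_of_ne_one (δ : K →* Multiplicative (ZMod ℓ)) (hδ : δ ≠ 1) : δ.ker.index = ℓ := by
  rw [Subgroup.index_ker]
  have hcard : Nat.card (Multiplicative (ZMod ℓ)) = ℓ := Nat.card_zmod ℓ
  haveI : Fact (Nat.card (Multiplicative (ZMod ℓ))).Prime := by rw [hcard]; exact hℓ
  rcases δ.range.eq_bot_or_eq_top_of_prime_card with h | h
  · exact absurd (MonoidHom.range_eq_bot_iff.mp h) hδ
  · rw [h, Subgroup.card_top, hcard]

/-- **Two non-trivial characters `δ, δ' : K → ℤ/ℓ` with open kernels of a Hausdorff group with a dense cyclic subgroup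
differ by a unit: `δ' = u · δ`, `u ≠ 0`** (their kernels are THE closed subgroup of index `ℓ`). [cite: MochizukiSemiAnbd2006, Ex. 2.10 p.31] -/
theorem exists_unit_mul_of_dense_zpowers {z : K} (hz : (Subgroup.zpowers z).topologicalClosure = ⊤)
    (δ δ' : K →* Multiplicative (ZMod ℓ)) (hδo : IsOpen (δ.ker : Set K)) (hδ'o : IsOpen (δ'.ker : Set K))
    (hδ : δ ≠ 1) (hδ' : δ' ≠ 1) :
    ∃ u : ZMod ℓ, u ≠ 0 ∧ ∀ k, toAdd (δ' k) = u * toAdd (δ k) := by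
  haveI : Fact ℓ.Prime := hℓ
  have hker : δ.ker = δ'.ker :=
    eq_of_index_eq_of_dense_zpowers hz hℓ.out.pos δ.ker δ'.ker (δ.ker.isClosed_of_isOpen hδo)
      (δ'.ker.isClosed_of_isOpen hδ'o) (index_ker_eq_of_ne_one δ hδ) (index_ker_eq_of_ne_one δ' hδ')
  -- a witness of non-triviality
  obtain ⟨k₀, hk₀⟩ : ∃ k₀, δ k₀ ≠ 1 := by
    by_contra hcon
    exact hδ (MonoidHom.ext fun k => not_not.mp fun hk => hcon ⟨k, hk⟩)
  set a : ZMod ℓ := toAdd (δ k₀) with ha_def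
  set a' : ZMod ℓ := toAdd (δ' k₀) with ha'_def
  have ha : a ≠ 0 := fun h => hk₀ (by rw [← ofAdd_toAdd (δ k₀), ← ha_def, h, ofAdd_zero])
  have hk₀' : δ' k₀ ≠ 1 := fun h => by
    have : k₀ ∈ δ.ker := by rw [hker]; exact h
    exact hk₀ this
  have ha' : a' ≠ 0 := fun h => hk₀' (by rw [← ofAdd_toAdd (δ' k₀), ← ha'_def, h, ofAdd_zero])
  refine ⟨a' * a⁻¹, mul_ne_zero ha' (inv_ne_zero ha), fun k => ?_⟩
  -- `k · k₀^{-m} ∈ Ker δ = Ker δ'` for `m` with `m·a = δ(k)`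
  set m : ℕ := (toAdd (δ k) * a⁻¹).val with hm_def
  have hm : (m : ZMod ℓ) * a = toAdd (δ k) := by
    rw [hm_def, ZMod.natCast_zmod_val, inv_mul_cancel_right₀ ha]
  have hmem : k * (k₀ ^ m)⁻¹ ∈ δ.ker := by
    rw [MonoidHom.mem_ker, map_mul, map_inv, map_pow, ← ofAdd_toAdd (δ k), ← ofAdd_toAdd (δ k₀), ← ha_def,
      ← ofAdd_nsmul, ← ofAdd_neg, ← ofAdd_add, ofAdd_eq_one, nsmul_eq_mul, hm, add_neg_cancel]
  rw [hker, MonoidHom.mem_ker, map_mul, map_inv, map_pow, ← ofAdd_toAdd (δ' k), ← ofAdd_toAdd (δ' k₀),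
    ← ha'_def, ← ofAdd_nsmul, ← ofAdd_neg, ← ofAdd_add, ofAdd_eq_one, nsmul_eq_mul, add_neg_eq_zero] at hmem
  rw [hmem, ← hm, mul_comm (m : ZMod ℓ) a, ← mul_assoc, inv_mul_cancel_right₀ ha, mul_comm]

end Unit

/-! ### 0.6 Gluing data on the plane `𝔽_ℓ²`: functionals, transitivity of `GL₂(𝔽_ℓ)` on non-zero vectors, and the
intertwiner of two line-valued characters of a topologically cyclic group -/

section Plane

variable {ℓ : ℕ} [hℓ : Fact ℓ.Prime]

/-- A homomorphism with open kernel into a discrete group is continuous. [cite: MochizukiSemiAnbd2006, Ex. 2.10 p.31] -/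
theorem continuous_of_isOpen_ker {P : Type*} [Group P] [TopologicalSpace P] [IsTopologicalGroup P]
    {M : Type*} [Group M] [TopologicalSpace M] [DiscreteTopology M] (χ : P →* M) (hχ : IsOpen (χ.ker : Set P)) :
    Continuous χ := by
  refine continuous_def.mpr fun S _ => isOpen_iff_forall_mem_open.mpr fun p hp => ?_
  refine ⟨(fun q => p⁻¹ * q) ⁻¹' (χ.ker : Set P), fun q hq => ?_, hχ.preimage (continuous_const.mul continuous_id),
    by simp⟩
  have hq' : χ (p⁻¹ * q) = 1 := hq
  rw [map_mul, map_inv, inv_mul_eq_one] at hq'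
  show χ q ∈ S
  rw [← hq']
  exact hp

/-- A linear functional `λ_d` on `𝔽_ℓ²` with `λ_d(d) = 1`, for `d ≠ 0`. [cite: MochizukiSemiAnbd2006, Ex. 2.10 p.31] -/
theorem exists_functional_eq_one (d : ZMod ℓ × ZMod ℓ) (hd : d ≠ 0) :
    ∃ lam : ZMod ℓ × ZMod ℓ →+ ZMod ℓ, lam d = 1 := by
  by_cases h1 : d.1 ≠ 0
  · refine ⟨(AddMonoidHom.mulLeft d.1⁻¹).comp (AddMonoidHom.fst _ _), ?_⟩
    simp [inv_mul_cancel₀ h1]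
  · have h2 : d.2 ≠ 0 := fun h2 => hd (Prod.ext (not_not.mp h1) h2)
    refine ⟨(AddMonoidHom.mulLeft d.2⁻¹).comp (AddMonoidHom.snd _ _), ?_⟩
    simp [inv_mul_cancel₀ h2]

/-- On the line through `d`, a functional with `λ(d) = 1` is a coordinate: `m = λ(m) · d` (written with the
natural-number representative of `λ(m)`). [cite: MochizukiSemiAnbd2006, Ex. 2.10 p.31] -/
theorem eq_smul_of_mem_zmultiples {d : ZMod ℓ × ZMod ℓ} (lam : ZMod ℓ × ZMod ℓ →+ ZMod ℓ) (hlam : lam d = 1)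
    {m : ZMod ℓ × ZMod ℓ} (hm : m ∈ AddSubgroup.zmultiples d) : m = (lam m).val • d := by
  obtain ⟨k, rfl⟩ := AddSubgroup.mem_zmultiples_iff.mp hm
  rw [map_zsmul, hlam, ← Nat.cast_smul_eq_nsmul (ZMod ℓ), ZMod.natCast_zmod_val, zsmul_one, Int.cast_smul_eq_zsmul]

/-- **`GL₂(𝔽_ℓ)` is transitive on non-zero vectors**: for `d, d' ≠ 0` there is an additive automorphism `A` of
`𝔽_ℓ²` with `A d = d'`. [cite: MochizukiSemiAnbd2006, Ex. 2.10 p.31] -/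
theorem exists_addEquiv_apply_eq (d d' : ZMod ℓ × ZMod ℓ) (hd : d ≠ 0) (hd' : d' ≠ 0) :
    ∃ A : ZMod ℓ × ZMod ℓ ≃+ ZMod ℓ × ZMod ℓ, A d = d' := by
  -- `φ_v : e₁ ↦ v` for every non-zero `v`; then `A := φ_{d'} ∘ φ_d⁻¹`
  have key : ∀ v : ZMod ℓ × ZMod ℓ, v ≠ 0 → ∃ φ : ZMod ℓ × ZMod ℓ ≃+ ZMod ℓ × ZMod ℓ, φ (1, 0) = v := by
    rintro ⟨a, b⟩ hv
    by_cases ha : a ≠ 0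
    · refine ⟨⟨⟨fun q => (a * q.1, b * q.1 + a⁻¹ * q.2), fun q => (a⁻¹ * q.1, a * (q.2 - b * a⁻¹ * q.1)),
        fun q => ?_, fun q => ?_⟩, fun q q' => ?_⟩, ?_⟩
      · obtain ⟨x, y⟩ := q
        simp only [Prod.mk.injEq]
        constructor
        · rw [← mul_assoc, inv_mul_cancel₀ ha, one_mul]
        · field_simp
          ring
      · obtain ⟨x, y⟩ := q
        simp only [Prod.mk.injEq]
        constructor
        · rw [← mul_assoc, mul_inv_cancel₀ ha, one_mul]
        · field_simp
          ring
      · obtain ⟨x, y⟩ := q; obtain ⟨x', y'⟩ := q'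
        simp only [Prod.mk_add_mk, Prod.mk.injEq]
        constructor <;> ring
      · change (a * 1, b * 1 + a⁻¹ * 0) = (a, b)
        simp
    · have ha0 : a = 0 := not_not.mp ha
      have hb : b ≠ 0 := fun hb => hv (Prod.ext ha0 hb)
      refine ⟨⟨⟨fun q => (-(b⁻¹ * q.2), b * q.1), fun q => (b⁻¹ * q.2, -(b * q.1)), fun q => ?_, fun q => ?_⟩,
        fun q q' => ?_⟩, ?_⟩
      · obtain ⟨x, y⟩ := q
        simp only [Prod.mk.injEq]
        constructor
        · rw [← mul_assoc, inv_mul_cancel₀ hb, one_mul]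
        · rw [mul_neg, ← mul_assoc, mul_inv_cancel₀ hb, one_mul, neg_neg]
      · obtain ⟨x, y⟩ := q
        simp only [Prod.mk.injEq]
        constructor
        · rw [mul_neg, ← mul_assoc, inv_mul_cancel₀ hb, one_mul, neg_neg]
        · rw [← mul_assoc, mul_inv_cancel₀ hb, one_mul]
      · obtain ⟨x, y⟩ := q; obtain ⟨x', y'⟩ := q'
        simp only [Prod.mk_add_mk, Prod.mk.injEq]
        constructor <;> ring
      · change (-(b⁻¹ * 0), b * 1) = (a, b)
        simp [ha0]
  obtain ⟨φ, hφ⟩ := key d hd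
  obtain ⟨φ', hφ'⟩ := key d' hd'
  exact ⟨φ.symm.trans φ', by rw [AddEquiv.trans_apply, ← hφ, AddEquiv.symm_apply_apply, hφ']⟩

variable {K : Type*} [Group K] [TopologicalSpace K] [IsTopologicalGroup K] [T2Space K]

/-- **The intertwiner.**  Let `K` be a Hausdorff topological group with a dense cyclic subgroup, and
`ψ, ψ' : K → 𝔽_ℓ²` (multiplicative notation) non-trivial homomorphisms with open kernels whose images lie on the lines
through `d ≠ 0`, resp. `d' ≠ 0`.  Then some bijection — indeed additive automorphism — `A` of `𝔽_ℓ²` intertwines the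
two translation actions of `K`: `A(ψ'(t) · m) = ψ(t) · A(m)` (so the two `K`-sets are isomorphic).  Proof: `ψ = d·δ`,
`ψ' = d'·δ'` for `ℤ/ℓ`-characters `δ, δ'`; `δ = u·δ'` by `exists_unit_mul_of_dense_zpowers`; take `A` linear with
`A(d') = u·d`. [cite: MochizukiSemiAnbd2006, Ex. 2.10 p.31] -/
theorem exists_intertwiner {z : K} (hz : (Subgroup.zpowers z).topologicalClosure = ⊤)
    (ψ ψ' : K →* Multiplicative (ZMod ℓ × ZMod ℓ)) (hψo : IsOpen (ψ.ker : Set K)) (hψ'o : IsOpen (ψ'.ker : Set K))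
    {d d' : ZMod ℓ × ZMod ℓ} (hd : d ≠ 0) (hd' : d' ≠ 0)
    (himψ : ∀ t, toAdd (ψ t) ∈ AddSubgroup.zmultiples d) (himψ' : ∀ t, toAdd (ψ' t) ∈ AddSubgroup.zmultiples d')
    (hψ : ψ ≠ 1) (hψ' : ψ' ≠ 1) :
    ∃ A : Multiplicative (ZMod ℓ × ZMod ℓ) ≃ Multiplicative (ZMod ℓ × ZMod ℓ),
      ∀ (t : K) (m : Multiplicative (ZMod ℓ × ZMod ℓ)), A (ψ' t * m) = ψ t * A m := by
  haveI : Fact ℓ.Prime := hℓ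
  obtain ⟨lam, hlam⟩ := exists_functional_eq_one d hd
  obtain ⟨lam', hlam'⟩ := exists_functional_eq_one d' hd'
  -- the `ℤ/ℓ`-characters `δ = λ ∘ ψ`, `δ' = λ' ∘ ψ'`
  let δ : K →* Multiplicative (ZMod ℓ) := lam.toMultiplicative.comp ψ
  let δ' : K →* Multiplicative (ZMod ℓ) := lam'.toMultiplicative.comp ψ'
  have hψδ : ∀ t, toAdd (ψ t) = (toAdd (δ t)).val • d := fun t => eq_smul_of_mem_zmultiples lam hlam (himψ t)
  have hψδ' : ∀ t, toAdd (ψ' t) = (toAdd (δ' t)).val • d' := fun t =>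
    eq_smul_of_mem_zmultiples lam' hlam' (himψ' t)
  have hδo : IsOpen (δ.ker : Set K) := by
    have : (δ.ker : Set K) = ψ ⁻¹' ((lam.toMultiplicative : _ →* _) ⁻¹' {1}) := by
      ext t; simp [δ, MonoidHom.mem_ker]
    rw [this]
    exact (continuous_of_isOpen_ker ψ hψo).isOpen_preimage _ (isOpen_discrete _)
  have hδ'o : IsOpen (δ'.ker : Set K) := by
    have : (δ'.ker : Set K) = ψ' ⁻¹' ((lam'.toMultiplicative : _ →* _) ⁻¹' {1}) := by
      ext t; simp [δ', MonoidHom.mem_ker]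
    rw [this]
    exact (continuous_of_isOpen_ker ψ' hψ'o).isOpen_preimage _ (isOpen_discrete _)
  have hδ : δ ≠ 1 := fun h => hψ (MonoidHom.ext fun t => by
    rw [MonoidHom.one_apply, ← ofAdd_toAdd (ψ t), hψδ t, show δ t = 1 from by rw [h]; rfl, toAdd_one,
      ZMod.val_zero, zero_smul, ofAdd_zero])
  have hδ' : δ' ≠ 1 := fun h => hψ' (MonoidHom.ext fun t => by
    rw [MonoidHom.one_apply, ← ofAdd_toAdd (ψ' t), hψδ' t, show δ' t = 1 from by rw [h]; rfl, toAdd_one,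
      ZMod.val_zero, zero_smul, ofAdd_zero])
  -- `δ = u · δ'`
  obtain ⟨u, hu, hδu⟩ := exists_unit_mul_of_dense_zpowers hz δ' δ hδ'o hδo hδ' hδ
  obtain ⟨A, hA⟩ := exists_addEquiv_apply_eq d' (u • d) hd' (smul_ne_zero hu hd)
  refine ⟨(toAdd.trans A.toEquiv).trans ofAdd, fun t m => ?_⟩
  change ofAdd (A (toAdd (ψ' t * m))) = ψ t * ofAdd (A (toAdd m))
  rw [toAdd_mul, map_add, hψδ' t, map_nsmul, hA, ofAdd_add, ← ofAdd_toAdd (ψ t), hψδ t]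
  congr 2
  rw [← Nat.cast_smul_eq_nsmul (ZMod ℓ), ZMod.natCast_zmod_val, ← Nat.cast_smul_eq_nsmul (ZMod ℓ),
    ZMod.natCast_zmod_val, smul_smul, hδu t, mul_comm]

/-- **The intertwiner in rank one**: two non-trivial `ℤ/ℓ`-characters `ψ, ψ'` with open kernels of a Hausdorff
group with a dense cyclic subgroup have isomorphic translation actions on `ℤ/ℓ` (`ψ' = u · ψ`; take `A m := u⁻¹ m`).
[cite: MochizukiSemiAnbd2006, Ex. 2.10 p.31] -/
theorem exists_intertwiner_zmod {z : K} (hz : (Subgroup.zpowers z).topologicalClosure = ⊤)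
    (ψ ψ' : K →* Multiplicative (ZMod ℓ)) (hψo : IsOpen (ψ.ker : Set K)) (hψ'o : IsOpen (ψ'.ker : Set K))
    (hψ : ψ ≠ 1) (hψ' : ψ' ≠ 1) :
    ∃ A : Multiplicative (ZMod ℓ) ≃ Multiplicative (ZMod ℓ),
      ∀ (t : K) (m : Multiplicative (ZMod ℓ)), A (ψ' t * m) = ψ t * A m := by
  haveI : Fact ℓ.Prime := hℓ
  obtain ⟨u, hu, hψu⟩ := exists_unit_mul_of_dense_zpowers hz ψ ψ' hψo hψ'o hψ hψ'
  refine ⟨(toAdd.trans (Equiv.mulLeft₀ u⁻¹ (inv_ne_zero hu))).trans ofAdd, fun t m => ?_⟩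
  change ofAdd (u⁻¹ * toAdd (ψ' t * m)) = ψ t * ofAdd (u⁻¹ * toAdd m)
  rw [toAdd_mul, hψu t, mul_add, ← mul_assoc, inv_mul_cancel₀ hu, one_mul, ofAdd_add, ofAdd_toAdd]

end Plane

end SurfaceTypeCharacters

end Literature.IUT.HodgeTheaters
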